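import Mathlib
import Summits.NavierStokesRegularity.NavierStokesRegularity.Theorems.TypeIQuarterGateScarEnvelopeTypeISatelliteTowerHullCells
import Summits.NavierStokesRegularity.NavierStokesRegularity.Theses.RecurrentProfiles

/-!
# Satellite tower for crux `ScarEnvelopeTypeI` (stmt-NavierStokesRegularity-23843) — Part Z9: EDGE 1589 ⇒ 23843 (crux `RecurrentProfiles.RecurrentLiouville` implies `TypeIQuarterGate.ScarEnvelopeTypeI`, through the cells); neither item proved; NOT a proof of 23843

Part Z9 of nsreg-p3 g28's ROUND-44 artefact, landed as a separate EDGE module on director-ns DIRECTOR-NS #262's ruling («EDGE 1589 ⇒ 23843; neither item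
proved; not a proof of 23843» — same status as the W4 ⟸ `LiouvilleConjectureNS` edges): `scarEnvelopeTypeI_of_recurrentLiouville` takes the registered OPEN
crux `Summit.NavierStokesRegularity.NavierStokesRegularity.Theses.RecurrentProfiles.RecurrentLiouville` (stmt-NavierStokesRegularity-1589) as a HYPOTHESIS and
concludes `…Theses.TypeIQuarterGate.ScarEnvelopeTypeI` (stmt-23843) through the census cells of Z6/Z8 — each cell is literally an instance of crux 1589. In the
cone this implication is not news (1590/1591/1593 closed); the content is the cell-by-cell reading. CONDITIONAL: 1589 is OPEN, so this proves NEITHER item.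

PROVENANCE: declaration texts VERBATIM from the HOME artefact of the instrument seat nsreg-p3 g27 (cell `pub/ns-regularity-ideate`):
`round-44/Junction44.lean` (sha16 `ec5c26d3f01f4277`, parts `partZ1…partZ7.lean`; a module written against the TREE, importing route
RecurrentProfiles' crux-1589 dynamics modules BY NAME; memo `round-44/ROUND-44.md` c316de8a95807228), scored PASS ★★ by referee ref3 g27
(`SCORE-p3-ROUND-44-0828.md` f10387a6f12e4133); the author cannot write under `Theorems/`
(`perm.theorems-prover-only`); landed by the prover ns-es-p1 g5 as landing hand of record (director-ns DIRECTOR-NS #237 (3)), split into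
≤ 400-line modules, `E3` spelled out, the artefact's `#guard_msgs … #print axioms` certificates not landed.
`--supports stmt-NavierStokesRegularity-23843 --as helper`.

HONEST FRAMING: instrument theorems about HYPOTHETICAL Type-I zoom limits (Albritton–Barker objects of the census of crux
`TypeIQuarterGate.ScarEnvelopeTypeI`, item 23843); the analytic input is the tree's closure engine (compactness
`local_typeI_compactness_twin_inBall`, sharpened to constant 1 in Part S1; Q1 whole-space), P1 rate inheritance, L8 persistence and the
tree's PROVED small-constant Liouville theorem; Parts R/S are order theory on the re-classing and closure lemmas.  NOTHING OPEN IS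
PROVED: 23843, (L′) `TypeILiouvilleAB` / (L′₀), the GLOBAL (S∞) = `CritAttained`, (M𝐈₁), (E1⁺), (E2ᵣ), route ExtremalTypeIConstant's
cruxes, N0 and Navier–Stokes regularity are OPEN; `critRate`, `levelCrit I`, `liouvilleRate` are `sInf`s that are `0` by junk value
when the defining set is empty (every statement using them carries the nonemptiness hypothesis explicitly).
-/

-- the summit-side namespace repeats a component by design (single-conjunct summit, D-0017)
set_option linter.dupNamespace false

open MeasureTheory Set Metric Filter Topology
open scoped ENNReal NNReal InnerProductSpace
open Literature.Analysis.FluidPDE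

namespace Summit.NavierStokesRegularity.NavierStokesRegularity.Cruxes.ScarEnvelopeTypeI.ZoomDictionary

section HullJunction

variable {U U₁ U₂ W : ℝ → (EuclideanSpace ℝ (Fin 3)) → (EuclideanSpace ℝ (Fin 3))}
  {P : ℝ → (EuclideanSpace ℝ (Fin 3)) → ℝ}
  {H : ℝ → (EuclideanSpace ℝ (Fin 3)) → (EuclideanSpace ℝ (Fin 3)) →L[ℝ] (EuclideanSpace ℝ (Fin 3))}
  {M : ℝ}

/-! ### Z9. DOMINATION: every cell is an instance of crux 1589 `RecurrentLiouville` -/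

/-- ★ **Z9. `RecurrentLiouville` (stmt-1589) ⇒ 23843, THROUGH the cells.**  In the cone this implication is
not news (`RecurrentLiouville ∧ RecurrentReduction` (1590, closed) give `NoTypeIRateProfile` (1593, closed) and a
Type-I blow-up has a rate profile (1591, closed), so 23843 would hold vacuously).  The point of THIS proof is
that each census cell of Z6/Z8 is LITERALLY an instance of crux 1589: an exactly past-DSS rooted A–B object is a
uniformly recurrent Type-I singularity model (`IsDiscretelySelfSimilar.isScalingUniformlyRecurrent` on the past
cut-off + `IsScalingUniformlyRecurrent.congr_ae`; class data `ABTower.prClass`, Z1), and the recurrent cell's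
model `w` is one by construction.  Hence (τ), (κ), (θ) of Z8 are three RESTRICTIONS of crux 1589 to very
special objects (doubly-minimal rooted census objects: tame-leaf-enveloped DSS / DSS necklace / DSS-free in a
recurrent hull), not new conjectures beside it. -/
theorem scarEnvelopeTypeI_of_recurrentLiouville
    (hRL : Summit.NavierStokesRegularity.NavierStokesRegularity.Theses.RecurrentProfiles.RecurrentLiouville) :
    Summit.NavierStokesRegularity.NavierStokesRegularity.Theses.TypeIQuarterGate.ScarEnvelopeTypeI := by
  by_contra h
  obtain ⟨M, I₀, Λ, hI₀, hcrit, hmin, hΛ, U, P, H, hdm, h0, hcell⟩ :=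
    dss_or_recurrent_doublyMin_of_not_scarEnvelopeTypeI h
  rcases hcell with ⟨lam0, hle, hdss, -⟩ | ⟨-, w, q, G, lam', hw, hG, hB, hdec, hsing, hrec, -⟩
  · have hlam : 1 < lam0 := lt_of_lt_of_le hΛ hle
    have hT : ABTower (levelCrit I₀) U P H := (hdm 0).1.1.1
    obtain ⟨hsw, hgr, hIb, hd⟩ := hT.prClass
    have hrecU : IsScalingUniformlyRecurrent U := by
      refine ((isDiscretelySelfSimilar_pastCut (one_pos.trans hlam) hdss).isScalingUniformlyRecurrent
        hlam).congr_ae ?_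
      refine (ae_restrict_mem (measurableSet_Iio.prod MeasurableSet.univ)).mono fun z hz => ?_
      have hz1 : z.1 < 0 := (Set.mem_prod.1 hz).1
      simp only [if_pos hz1]
    refine hRL U P H (levelCrit I₀) hsw hgr hIb hd hrecU ?_
    rw [prod_zero_eq]
    exact isBackwardSingularPoint_of_not_regPt h0
  · exact hRL w q G (levelCrit I₀) hw hG hB hdec hrec hsing

end HullJunction

end Summit.NavierStokesRegularity.NavierStokesRegularity.Cruxes.ScarEnvelopeTypeI.ZoomDictionary
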